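import Summits.BirchSwinnertonDyer.BirchSwinnertonDyer.Theorems.ManinLocalTwoThreeUDCLineKAtNine
import Summits.BirchSwinnertonDyer.BirchSwinnertonDyer.Theorems.ManinLocalTwoThreeShimuraQuotientLevelInstances
import Summits.BirchSwinnertonDyer.Rank1Residual.ManinAdditive.ShimuraThreeTorsion
import HarnessLib

/-!
# E-an-221's habitat, unconditionally: the Shimura branch of the K-line is EMPTY at every `N = 9M` with `3 ∤ φ(3M)`
(route `ManinLocalTwoThree`, crux C3 `ManinPrimeToThreeAtNine` stmt-BirchSwinnertonDyer-22968; cell bsd-f2-manin, C3 LEAD p1 gen 17;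
`--supports stmt-BirchSwinnertonDyer-22968`; node E-an-221 `ShimuraThreeTorsion.ShimuraThreeKernelForcesRationalThreeTorsionAtNine` of the
registered skeleton `kato_shift_three` v30/v31 — the ONE non-printed, non-analytic stub left on the line once (BI)_K lands)

WHAT.  `KummerShimura D u` (every `γ ∈ Γ₁(N)` has trivial Kummer period along the third-period `u`: `c·{∞,γ∞}_f ∈ ℤ·3u + 3Λ_E`) says, by
-an's DICTΣ (`kummerShimuraLattice_holds`, p735594), that `Λ₁(f)` lies in the LINE `ℤ·(3u/c) + 3Λ₀(f) ⊊ Λ₀(f)`; so `Λ₁(f) ≠ Λ₀(f)`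
(`periodLatticeGamma1_ne_of_subset_line`: a rank-2 lattice is not cyclic mod 3).  The lead's cuspidal-inertia collapse (p1 g15,
`…ShimuraQuotientLevelInstances`: `Λ₀(f)/Λ₁(f)` is a quotient of `(ℤ/uv)ˣ/{±1}` for `N = u²v`, killed by `3` at `9 ∣ N`) gives
`Λ₁(f) = Λ₀(f)` whenever `3 ∤ φ(uv)/2`.  Hence, UNCONDITIONALLY:
* §1 `kummerShimura_line` — DICTΣ without the (idle) hypothesis `u ∉ Λ_E`; `not_kummerShimura_of_periodLatticeGamma1_eq` — `Λ₁(f) = Λ₀(f)` ⟹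
  NO `u` with `3u ∈ Λ_E` is Kummer–Shimura;
* §2 `three_dvd_half_totient_of_kummerShimura` — `N = u²v`, `uv > 2`, `9 ∣ N`, `KummerShimura D u'` ⟹ `3 ∣ φ(uv)/2` (the `3`-part of
  `(ℤ/uv)ˣ/{±1}` is where a Shimura `3`-kernel must come from); `not_kummerShimura_of_nine_mul_of_coprime_totient` (`N = 9M`, `3 ∤ φ(3M)`),
  `not_kummerShimura_of_nine_mul_prime` (`N = 9p`, `p ≡ 2 (mod 3)`): levels `18, 36, 45, 72, 90, 99, 144, 153, 180, 198, …`;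
* §3 **E-an-221 holds outright on that locus** (`shimuraThreeKernelForcesRationalThreeTorsionAtNine_of_nine_mul_of_coprime_totient`, vacuously),
  and the STUB CUT for the C3 skeleton: **`shimuraThreeKernelForcesRationalThreeTorsionAtNine_of_offCoprime`** — E-an-221 follows from its
  restriction E-an-221♭ to the levels with `3 ∣ φ(N/3)` (for `N = 9M`: `φ(N/3) = φ(3M)`).  All ten residual RES₃♭ classes `N ≤ 5000`
  (270c1 … 2430m1, MEMO-an §82) have `27 ∣ N`, inside ♭; the cut removes the `9 ∥ N` levels whose cofactor has no prime `≡ 1 (mod 3)`.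
  The same cut applies verbatim to E-an-212 `NonShimuraMuThreeOfNonStarKodairaAtNine` (its conclusion `¬ KummerShimura D u` holds on the
  coprime locus for every Kodaira type) — recorded, not restated here.

HONEST FRAMING.  Unconditional lattice theorems about the tree's `Λ₀(f)`, `Λ₁(f)`; they settle E-an-221 only where its hypothesis is
contradictory.  E-an-221 on the ♭-locus, RES₃♭, C3, Manin's conjecture and BSD are NOT proved.  No definitions, no named facts, no sorry.
[cite: LingOesterle1991, §1, Thm. 1 and Thm. 6 (structure of Σ(N); shape)] [cite: Stevens1989, §2 (the Shimura covering E₁ → E₀; shape)]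
-/

set_option autoImplicit false
-- lint-debt: the directory name repeats the summit name (sibling precedent `ManinLocalTwoThreeUDCLineKAtNine.lean`)
set_option linter.dupNamespace false

noncomputable section

open scoped Classical MatrixGroups ModularForm PeriodPair
open CongruenceSubgroup Complex
open WeierstrassCurve Literature.NumberTheory.EllipticCurves Literature.NumberTheory.EllipticCurves.ModularForms
open Summit.BirchSwinnertonDyer.Rank1Residual.ManinAdditive.CuspidalKummer
open Summit.BirchSwinnertonDyer.Rank1Residual.ManinAdditive.CuspidalKummerThree
open Summit.BirchSwinnertonDyer.Rank1Residual.ManinAdditive.UDCKummerLine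
open Summit.BirchSwinnertonDyer.Rank1Residual.ManinAdditive.UDCKummerLineK
open Summit.BirchSwinnertonDyer.Rank1Residual.ManinAdditive.ShimuraThreeTorsion

namespace Summit.BirchSwinnertonDyer.BirchSwinnertonDyer.Theorems.ManinLocalTwoThree.SigmaHabitat

variable {W : WeierstrassCurve ℚ} [W.IsElliptic] {N : ℕ} [NeZero N]

/-! ## §1 DICTΣ without `u ∉ Λ_E`, and no Shimura third-period when `Λ₁(f) = Λ₀(f)` -/

omit [W.IsElliptic] in
/-- **DICTΣ (line form), for EVERY `u` with `3u ∈ Λ_E`.**  If every `γ ∈ Γ₁(N)` has trivial Kummer period along `u`, then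
`Λ₁(f) ⊆ ℤ·(3u/c) + 3Λ₀(f)` (-an's `kummerShimuraLattice_holds` with its idle hypothesis `u ∉ Λ_E` dropped; same closure argument). [folklore] -/
theorem kummerShimura_line (D : ModularParametrizationData W N)
    (hopt : ∀ z ∈ D.L.lattice, ∃ w ∈ periodLattice D.f, z = D.c * w) {u : ℂ} (hS : KummerShimura D u) :
    ∀ w ∈ periodLatticeGamma1 D.f, ∃ k : ℤ, ∃ v ∈ periodLattice D.f, w = k * (3 * u / D.c) + 3 * v := by
  intro w hw
  have hc := cast_c_ne_zero_of_latticeOptimal D hopt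
  let G : AddSubgroup ℂ :=
    { carrier := {w | ∃ k : ℤ, ∃ v ∈ periodLattice D.f, w = k * (3 * u / D.c) + 3 * v}
      zero_mem' := ⟨0, 0, zero_mem _, by simp⟩
      add_mem' := by
        rintro _ _ ⟨k, v, hv, rfl⟩ ⟨k', v', hv', rfl⟩
        exact ⟨k + k', v + v', add_mem hv hv', by push_cast; ring⟩
      neg_mem' := by
        rintro _ ⟨k, v, hv, rfl⟩
        exact ⟨-k, -v, neg_mem hv, by push_cast; ring⟩ }
  suffices h : periodLatticeGamma1 D.f ≤ G from h hw
  change AddSubgroup.closure _ ≤ G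
  refine (AddSubgroup.closure_le G).mpr ?_
  rintro _ ⟨γ, rfl⟩
  obtain ⟨k, ν, hν, hk⟩ := hS ⟨(γ : SL(2, ℤ)), Gamma1_in_Gamma0 N γ.2⟩ γ.2
  obtain ⟨v, hv, hνv⟩ := hopt ν hν
  refine ⟨k, v, hv, ?_⟩
  rw [hνv] at hk
  field_simp
  linear_combination hk

omit [W.IsElliptic] in
/-- **`Λ₁(f) = Λ₀(f)` ⟹ no third-period is Kummer–Shimura.**  For a lattice-optimal datum with `Λ₁(f) = Λ₀(f)` (Stevens' curve = the
optimal curve) and ANY `u` with `3u ∈ Λ_E`, some `γ ∈ Γ₁(N)` has a non-trivial Kummer period along `u`: otherwise `Λ₀ = Λ₁` would lie in a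
line mod `3`. [folklore] -/
theorem not_kummerShimura_of_periodLatticeGamma1_eq (D : ModularParametrizationData W N)
    (hopt : ∀ z ∈ D.L.lattice, ∃ w ∈ periodLattice D.f, z = D.c * w)
    (hΛ : periodLatticeGamma1 D.f = periodLattice D.f) {u : ℂ} (hu₂ : 3 * u ∈ D.L.lattice) :
    ¬ KummerShimura D u :=
  fun hS ↦ periodLatticeGamma1_ne_of_subset_line D hopt hu₂ (kummerShimura_line D hopt hS) hΛ

/-! ## §2 A Shimura third-period needs `3 ∣ φ(uv)/2` for every factorisation `N = u²v` -/

omit [W.IsElliptic] in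
/-- **`KummerShimura D u'` ⟹ `3 ∣ φ(uv)/2`** (`N = u²v`, `uv > 2`, `9 ∣ N`, lattice-optimal): otherwise `3` is prime to the
half-exponent of `(ℤ/uv)ˣ/{±1}` and the cuspidal-inertia collapse gives `Λ₁(f) = Λ₀(f)`. [cite: LingOesterle1991, Thm. 1 and Thm. 6 (shape)] -/
theorem three_dvd_half_totient_of_kummerShimura (D : ModularParametrizationData W N)
    (hopt : ∀ z ∈ D.L.lattice, ∃ w ∈ periodLattice D.f, z = D.c * w) (h9 : 3 ^ 2 ∣ N)
    {u v : ℕ} (hu : u ≠ 0) (hN : (N : ℤ) = (u : ℤ) ^ 2 * v) (huv : 2 < u * v)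
    {u' : ℂ} (hu₂ : 3 * u' ∈ D.L.lattice) (hS : KummerShimura D u') :
    3 ∣ Nat.totient (u * v) / 2 := by
  by_contra h3
  have hcop : Nat.Coprime 3 (Nat.totient (u * v) / 2) := (Nat.Prime.coprime_iff_not_dvd Nat.prime_three).mpr h3
  exact not_kummerShimura_of_periodLatticeGamma1_eq D hopt
    (periodLatticeGamma1_eq_of_natMul_mem_of_coprime_half_totient D.f hu hN huv
      (fun z hz ↦ three_mul_mem_periodLatticeGamma1_of_nine_dvd D h9 hz) hcop) hu₂ hS

omit [W.IsElliptic] in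
/-- **No Shimura third-period at `N = 9M`, `3 ∤ φ(3M)`** (levels `18, 36, 45, 72, 90, 99, 144, 153, 180, 198, …`): for every lattice-optimal
datum and every `u` with `3u ∈ Λ_E`, `¬ KummerShimura D u`. [cite: LingOesterle1991, Thm. 1 and Thm. 6 (shape)] -/
theorem not_kummerShimura_of_nine_mul_of_coprime_totient {M : ℕ} (hN : N = 9 * M)
    (hcop : Nat.Coprime 3 (Nat.totient (3 * M))) (D : ModularParametrizationData W N)
    (hopt : ∀ z ∈ D.L.lattice, ∃ w ∈ periodLattice D.f, z = D.c * w) {u : ℂ} (hu₂ : 3 * u ∈ D.L.lattice) :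
    ¬ KummerShimura D u :=
  not_kummerShimura_of_periodLatticeGamma1_eq D hopt (periodLatticeGamma1_eq_of_nine_mul_of_coprime_totient hN hcop D) hu₂

omit [W.IsElliptic] in
/-- **No Shimura third-period at `N = 9p`, `p ≡ 2 (mod 3)` prime.** [cite: LingOesterle1991, Thm. 1 and Thm. 6 (shape)] -/
theorem not_kummerShimura_of_nine_mul_prime {p : ℕ} (hp : p.Prime) (hp3 : p % 3 = 2) [NeZero (9 * p)]
    (D : ModularParametrizationData W (9 * p))
    (hopt : ∀ z ∈ D.L.lattice, ∃ w ∈ periodLattice D.f, z = D.c * w) {u : ℂ} (hu₂ : 3 * u ∈ D.L.lattice) :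
    ¬ KummerShimura D u :=
  not_kummerShimura_of_periodLatticeGamma1_eq D hopt (periodLatticeGamma1_eq_of_nine_mul_prime hp hp3 D) hu₂

/-- At `9 ∣ N`: `N = 9·(N/9)` and `N/3 = 3·(N/9)`. [folklore] -/
theorem eq_nine_mul_div_of_nine_dvd (h9 : 3 ^ 2 ∣ N) : N = 9 * (N / 9) ∧ N / 3 = 3 * (N / 9) := by
  obtain ⟨M, hM⟩ := h9
  subst hM
  constructor <;> omega

omit [W.IsElliptic] in
/-- **A Shimura third-period at `9 ∣ N` forces `3 ∣ φ(N/3)`** (`N = 9M`, `φ(N/3) = φ(3M)`): the habitat of E-an-221 / E-an-212. [folklore] -/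
theorem three_dvd_totient_div_three_of_kummerShimura (D : ModularParametrizationData W N)
    (hopt : ∀ z ∈ D.L.lattice, ∃ w ∈ periodLattice D.f, z = D.c * w) (h9 : 3 ^ 2 ∣ N)
    {u : ℂ} (hu₂ : 3 * u ∈ D.L.lattice) (hS : KummerShimura D u) :
    3 ∣ Nat.totient (N / 3) := by
  by_contra h3
  obtain ⟨hN, hN3⟩ := eq_nine_mul_div_of_nine_dvd (N := N) h9
  rw [hN3] at h3
  exact not_kummerShimura_of_nine_mul_of_coprime_totient hN ((Nat.Prime.coprime_iff_not_dvd Nat.prime_three).mpr h3)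
    D hopt hu₂ hS

/-! ## §3 E-an-221 on the coprime locus, and the stub cut E-an-221 ⟸ E-an-221♭ -/

/-- **E-an-221 HOLDS OUTRIGHT at `N = 9M` with `3 ∤ φ(3M)`** (vacuously: its Shimura hypothesis is contradictory there). [folklore] -/
theorem shimuraThreeKernelForcesRationalThreeTorsionAtNine_of_nine_mul_of_coprime_totient
    (W : WeierstrassCurve ℚ) [W.IsElliptic] [W.IsGloballyMinimal] {N : ℕ} [NeZero N]
    (D : ModularParametrizationData W N)
    (hopt : ∀ z ∈ D.L.lattice, ∃ w ∈ periodLattice D.f, z = D.c * w) {M : ℕ} (hN : N = 9 * M)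
    (hcop : Nat.Coprime 3 (Nat.totient (3 * M)))
    (u : ℂ) (hu₂ : 3 * u ∈ D.L.lattice) (hS : KummerShimura D u) :
    ∃ X Y : ℚ, IsShortThreeTorsion W D.c X Y :=
  absurd hS (not_kummerShimura_of_nine_mul_of_coprime_totient hN hcop D hopt hu₂)

/-- **THE STUB CUT: E-an-221 ⟸ E-an-221♭**, where E-an-221♭ is E-an-221 `ShimuraThreeKernelForcesRationalThreeTorsionAtNine` restricted to the
levels with `3 ∣ φ(N/3)` (the only levels at which a Shimura third-period can exist, `three_dvd_totient_div_three_of_kummerShimura`) — so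
E-an-221 and E-an-221♭ are the SAME statement; the C3 skeleton may carry the ♭-form as its stub. [folklore] -/
theorem shimuraThreeKernelForcesRationalThreeTorsionAtNine_of_offCoprime
    (h : ∀ (W : WeierstrassCurve ℚ) [W.IsElliptic] [W.IsGloballyMinimal] {N : ℕ} [NeZero N]
      (D : ModularParametrizationData W N),
      (∀ z ∈ D.L.lattice, ∃ w ∈ periodLattice D.f, z = D.c * w) → 3 ^ 2 ∣ N → 3 ∣ Nat.totient (N / 3) →
      ∀ u : ℂ, u ∉ D.L.lattice → 3 * u ∈ D.L.lattice → KummerShimura D u →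
      ∃ X Y : ℚ, IsShortThreeTorsion W D.c X Y) :
    ShimuraThreeKernelForcesRationalThreeTorsionAtNine :=
  fun W _ _ _ _ D hopt h9 u hu₁ hu₂ hS ↦
    h W D hopt h9 (three_dvd_totient_div_three_of_kummerShimura D hopt h9 hu₂ hS) u hu₁ hu₂ hS

end Summit.BirchSwinnertonDyer.BirchSwinnertonDyer.Theorems.ManinLocalTwoThree.SigmaHabitat

end
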